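import Mathlib
import HarnessLib
import Summits.Ventures.LatticeQCDFlow.Scoring.GaussianCochranReduction

/-!
# THE NON-CENTRAL COCHRAN REDUCTION: FOR EVERY UNIT `u` AND EVERY SHIFT `θ`,
# `N^{⊗ι}{z | ‖z + θ‖² − ⟨u, z + θ⟩² ≤ c} = N^{⊗ι}{z | (z_{r₁} + κ)² + Σ_{r ≠ r₀, r₁} z_r² ≤ c}`,
# `κ² = ‖θ‖² − ⟨u, θ⟩²`; HENCE THE `k`-ARM HOMOGENEITY FUNCTIONAL WITH DIFFERENT CENTRES `μ_i`
# IS A SHIFTED BALL WITH `κ² = Σ_i (μ_i − μ̄_w)²/σ_i²` (textbook: non-central `χ²_{k−1}(κ²)`)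

HONEST FRAMING: exact (Metropolis-corrected) sampling algorithms for lattice gauge theory;
figures of merit are autocorrelation/cost numbers at stated couplings and volumes; no
continuum-physics claim.

Venture `LatticeQCDFlow` (cell pub-lqcd), topic `Scoring`; FANOUT row 4 (`s0-u1-b`, GEN-34).
NEW WORK of the cell (classical), no definition, nothing cited as a fact (the non-central `χ²`
law / Cochran's theorem are NAMED ONLY; Mathlib has no `χ²` law, central or not, so the shifted-ball
event `{(z_{r₁} + κ)² + Σ_{r ≠ r₀, r₁} z_r² ≤ c}` under `N(0,1)^{⊗ι}` IS the definition-level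
"`P(χ²_{k−1}(κ²) ≤ c)`").

WHY (row 4).  `Scoring/GaussianCochranReduction` reduced the NULL law of the one-shot `k`-arm
inverse-variance homogeneity statistic `Q = Σ_i (x_i − m̂)²/σ_i²` (all arms with the SAME centre) to
`k − 1` squares, and `Scoring/KArmHomogeneityPower` showed power one against FIXED different
centres.  The POWER FUNCTION under LOCAL alternatives (centres `a + h_r/√n`, listed NOT CLAIMED by
both files and by `Scoring/KArmHomogeneityCoverage`) needs the law of `Q` when the standardised arm
estimates are independent `N(μ_i, σ_i²)` with DIFFERENT `μ_i`: this file proves, at the Gaussian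
level and for every index type, that it is the law of a SHIFTED BALL functional
`(z_{r₁} + κ)² + Σ_{r ≠ r₀, r₁} z_r²` of a standard Gaussian vector, with the single non-centrality
parameter `κ = √(Σ_i (μ_i − μ̄_w)²/σ_i²)` — the homogeneity statistic OF THE TRUE CENTRES with the
true variances (`μ̄_w` their inverse-variance mean).  Device: an orthonormal basis of
`EuclideanSpace ℝ ι` whose `r₀`-th vector is `u` and whose `r₁`-th vector carries the component of
`θ` orthogonal to `u` (Mathlib's `Orthonormal.exists_orthonormalBasis_extension_of_card_eq`); its
coordinate map is a linear isometry, which preserves `N(0,1)^{⊗ι}`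
(`measurePreserving_euclidean_isometry_pi` of `Scoring/GaussianCochranReduction`).  The monotonicity
of the shifted-ball probability in `κ` and the chain-level local-power theorem are separate files.

## Content

* `exists_orthonormalBasis_two` (§1) — `r₀ ≠ r₁`, `u ⊥ v` unit vectors: an orthonormal basis `b`
  with `b r₀ = u`, `b r₁ = v`; `exists_orthonormalBasis_unit_shift` — for a unit `u` and ANY `θ`:
  `b` with `b r₀ = u` and `θ − ⟨u,θ⟩u = ‖θ − ⟨u,θ⟩u‖ • b r₁`.
* `norm_sq_sub_inner_sq_shift_eq` (§1) — for such `b`, every `w`: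
  `‖w + θ‖² − ⟨u, w + θ⟩² = (⟨b r₁, w⟩ + κ)² + Σ_{r ≠ r₀, r₁} ⟨b r, w⟩²`.
* **`pi_gaussianReal_noncentral_cochran_eq`** (§2) — `Σ_i u_i² = 1`, any `θ : ι → ℝ`, `r₀ ≠ r₁`,
  Borel `B`: `N^{⊗ι}{z | Σ_i (z_i + θ_i)² − (Σ_i u_i (z_i + θ_i))² ∈ B}
     = N^{⊗ι}{z | (z_{r₁} + √(Σ_i θ_i² − (Σ_i u_i θ_i)²))² + Σ_{r ≠ r₀, r₁} z_r² ∈ B}`;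
  `shiftedBall_zero_eq_erase` (`κ = 0` is the central event of `Scoring/GaussianCochranReduction`).
* `homogeneity_statistic_centres_eq` (§3) — `x_i = μ_i + σ_i z_i`:
  `Σ_i (x_i − m̂)²/σ_i² = Σ_i (z_i + μ_i/σ_i)² − (Σ_i (z_i + μ_i/σ_i)/σ_i)²/(Σ_i σ_i⁻²)`;
  `noncentrality_sq_eq` — `Σ_i (μ_i/σ_i)² − (Σ_i u_i μ_i/σ_i)² = Σ_i (μ_i − μ̄_w)²/σ_i²`.
* **`pi_gaussianReal_homogeneity_centres_eq_shiftedBall`** (§3) — `σ_i > 0`, any centres `μ_i`,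
  Borel `B`: `N^{⊗ι}{z | Σ_i ((μ_i + σ_i z_i) − m̂(z))²/σ_i² ∈ B}
     = N^{⊗ι}{z | (z_{r₁} + κ)² + Σ_{r ≠ r₀, r₁} z_r² ∈ B}`, `κ = √(Σ_i (μ_i − μ̄_w)²/σ_i²)`.

Mathlib + `Scoring/GaussianCochranReduction` only.  [ours] throughout.
NOT CLAIMED here: monotonicity / limits in `κ` (separate file), the chain-level theorem, densities,
anything numerical.
-/

open MeasureTheory ProbabilityTheory Filter Topology Finset

namespace Summit.Ventures.LatticeQCDFlow.Scoring

open Set WithLp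
open scoped RealInnerProductSpace

/-! ## §1 An orthonormal basis adapted to a unit vector and a shift -/

section Basis

variable {ι : Type*} [Fintype ι] [DecidableEq ι]

/-- For `r₀ ≠ r₁` and orthonormal `u, v` there is an orthonormal basis of `EuclideanSpace ℝ ι` with
`b r₀ = u` and `b r₁ = v`. [ours] -/
theorem exists_orthonormalBasis_two {r₀ r₁ : ι} (h01 : r₀ ≠ r₁) {u v : EuclideanSpace ℝ ι}
    (hu : ‖u‖ = 1) (hv : ‖v‖ = 1) (huv : ⟪u, v⟫ = 0) :
    ∃ b : OrthonormalBasis ι ℝ (EuclideanSpace ℝ ι), b r₀ = u ∧ b r₁ = v := by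
  classical
  let w : ι → EuclideanSpace ℝ ι := fun i => if i = r₀ then u else if i = r₁ then v else 0
  have hw0 : w r₀ = u := by simp [w]
  have hw1 : w r₁ = v := by simp [w, h01.symm]
  have hvu : ⟪v, u⟫ = 0 := by rw [real_inner_comm]; exact huv
  have horth : Orthonormal ℝ (({r₀, r₁} : Set ι).restrict w) := by
    rw [orthonormal_iff_ite]
    rintro ⟨i, hi⟩ ⟨j, hj⟩
    simp only [Set.restrict_apply, Subtype.mk.injEq]
    simp only [Set.mem_insert_iff, Set.mem_singleton_iff] at hi hj
    rcases hi with rfl | rfl <;> rcases hj with rfl | rfl <;>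
      simp [hw0, hw1, hu, hv, huv, hvu, h01, h01.symm]
  obtain ⟨b, hb⟩ := horth.exists_orthonormalBasis_extension_of_card_eq (by simp)
  exact ⟨b, (hb r₀ (by simp)).trans hw0, (hb r₁ (by simp)).trans hw1⟩

/-- **Adapted basis**: for `r₀ ≠ r₁`, a unit `u` and ANY `θ` there is an orthonormal basis with
`b r₀ = u` whose `r₁`-th vector carries the component of `θ` orthogonal to `u`:
`θ − ⟨u,θ⟩u = ‖θ − ⟨u,θ⟩u‖ • b r₁`. [ours] -/
theorem exists_orthonormalBasis_unit_shift {r₀ r₁ : ι} (h01 : r₀ ≠ r₁) {u : EuclideanSpace ℝ ι}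
    (hu : ‖u‖ = 1) (θ : EuclideanSpace ℝ ι) :
    ∃ b : OrthonormalBasis ι ℝ (EuclideanSpace ℝ ι),
      b r₀ = u ∧ θ - ⟪u, θ⟫ • u = ‖θ - ⟪u, θ⟫ • u‖ • b r₁ := by
  set p := θ - ⟪u, θ⟫ • u with hp
  have huu : ⟪u, u⟫ = 1 := by rw [real_inner_self_eq_norm_sq, hu, one_pow]
  have hpu : ⟪u, p⟫ = 0 := by
    rw [hp, inner_sub_right, inner_smul_right, huu, mul_one, sub_self]
  by_cases hκ : ‖p‖ = 0
  · -- any unit vector orthogonal to `u` will do; take one from a basis through `u`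
    have horth : Orthonormal ℝ (({r₀} : Set ι).restrict fun _ : ι => u) := by
      rw [orthonormal_iff_ite]
      rintro ⟨i, hi⟩ ⟨j, hj⟩
      simp only [Set.mem_singleton_iff] at hi hj
      subst hi; subst hj
      simp [hu]
    obtain ⟨b, hb⟩ := horth.exists_orthonormalBasis_extension_of_card_eq (by simp)
    refine ⟨b, hb r₀ (by simp), ?_⟩
    rw [hκ, zero_smul]
    exact norm_eq_zero.1 hκ
  · set v := ‖p‖⁻¹ • p with hv
    have hv1 : ‖v‖ = 1 := by rw [hv]; exact norm_smul_inv_norm (norm_ne_zero_iff.1 hκ)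
    have huv : ⟪u, v⟫ = 0 := by rw [hv, inner_smul_right, hpu, mul_zero]
    obtain ⟨b, hb0, hb1⟩ := exists_orthonormalBasis_two h01 hu hv1 huv
    refine ⟨b, hb0, ?_⟩
    rw [hb1, hv, smul_smul, mul_inv_cancel₀ hκ, one_smul]

/-- **The two-index decomposition**: if `b r₀ = u` (unit) and `θ − ⟨u,θ⟩u = κ • b r₁`, then for
every `w`, `‖w + θ‖² − ⟨u, w + θ⟩² = (⟨b r₁, w⟩ + κ)² + Σ_{r ≠ r₀, r₁} ⟨b r, w⟩²`. [ours] -/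
theorem norm_sq_sub_inner_sq_shift_eq {r₀ r₁ : ι} (h01 : r₀ ≠ r₁)
    (b : OrthonormalBasis ι ℝ (EuclideanSpace ℝ ι)) {u θ : EuclideanSpace ℝ ι} (hb0 : b r₀ = u)
    {κ : ℝ} (hθ : θ - ⟪u, θ⟫ • u = κ • b r₁) (w : EuclideanSpace ℝ ι) :
    ‖w + θ‖ ^ 2 - ⟪u, w + θ⟫ ^ 2
      = (⟪b r₁, w⟫ + κ) ^ 2 + ∑ r ∈ (univ.erase r₀).erase r₁, ⟪b r, w⟫ ^ 2 := by
  have hP : ‖w + θ‖ ^ 2 - ⟪u, w + θ⟫ ^ 2 = ∑ r ∈ univ.erase r₀, ⟪b r, w + θ⟫ ^ 2 := by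
    rw [← b.sum_sq_inner_right (w + θ), ← hb0, Finset.sum_erase_eq_sub (Finset.mem_univ _)]
  rw [hP, ← Finset.add_sum_erase _ _ (Finset.mem_erase.2 ⟨h01.symm, Finset.mem_univ _⟩)]
  have hon := orthonormal_iff_ite.1 b.orthonormal
  have hθ' : θ = κ • b r₁ + ⟪u, θ⟫ • u := by rw [← hθ]; abel
  have hcoord : ∀ r, r ≠ r₀ → ⟪b r, θ⟫ = κ * (if r = r₁ then 1 else 0) := by
    intro r hr
    rw [hθ', inner_add_right, inner_smul_right, inner_smul_right, ← hb0, hon r r₁, hon r r₀,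
      if_neg hr]
    ring
  congr 1
  · rw [inner_add_right, hcoord r₁ h01.symm, if_pos rfl, mul_one]
  · refine Finset.sum_congr rfl fun r hr => ?_
    have hr1 : r ≠ r₁ := (Finset.mem_erase.1 hr).1
    have hr0 : r ≠ r₀ := (Finset.mem_erase.1 (Finset.mem_erase.1 hr).2).1
    rw [inner_add_right, hcoord r hr0, if_neg hr1, mul_zero, add_zero]

end Basis

/-! ## §2 The non-central Cochran reduction on `ι → ℝ` -/

section Cochran

variable {ι : Type*} [Fintype ι] [DecidableEq ι]

omit [DecidableEq ι] in
/-- `toLp (z + θ) = toLp z + toLp θ` and `‖toLp x‖² = Σ x_i²` bookkeeping: the non-central Cochran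
functional read in `EuclideanSpace`. -/
theorem sum_sq_add_sub_sq_eq_norm (z θ u : ι → ℝ) :
    ∑ i, (z i + θ i) ^ 2 - (∑ i, u i * (z i + θ i)) ^ 2
      = ‖(toLp 2 z : EuclideanSpace ℝ ι) + toLp 2 θ‖ ^ 2
        - ⟪(toLp 2 u : EuclideanSpace ℝ ι), toLp 2 z + toLp 2 θ⟫ ^ 2 := by
  have h1 : (toLp 2 z : EuclideanSpace ℝ ι) + toLp 2 θ = toLp 2 (z + θ) := rfl
  rw [h1, EuclideanSpace.real_norm_sq_eq, real_inner_comm, inner_toLp_toLp_eq_sum]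
  rfl

/-- **THE NON-CENTRAL COCHRAN REDUCTION.**  For every `u : ι → ℝ` with `Σ_i u_i² = 1`, every shift
`θ : ι → ℝ`, all `r₀ ≠ r₁` and every Borel `B`:
`N(0,1)^{⊗ι}{z | Σ_i (z_i + θ_i)² − (Σ_i u_i (z_i + θ_i))² ∈ B}
   = N(0,1)^{⊗ι}{z | (z_{r₁} + κ)² + Σ_{r ≠ r₀, r₁} z_r² ∈ B}` with `κ = √(Σ_i θ_i² − (Σ_i u_i θ_i)²)`
— the law of the shifted Cochran functional depends on `(u, θ)` only through the one number `κ`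
(textbook: non-central `χ²_{k−1}(κ²)`, `k = card ι`). [ours] -/
theorem pi_gaussianReal_noncentral_cochran_eq {r₀ r₁ : ι} (h01 : r₀ ≠ r₁) (u θ : ι → ℝ)
    (hu : ∑ i, u i ^ 2 = 1) {B : Set ℝ} (hB : MeasurableSet B) :
    (Measure.pi fun _ : ι => gaussianReal 0 1)
        {z : ι → ℝ | ∑ i, (z i + θ i) ^ 2 - (∑ i, u i * (z i + θ i)) ^ 2 ∈ B}
      = (Measure.pi fun _ : ι => gaussianReal 0 1)
        {z : ι → ℝ | (z r₁ + Real.sqrt (∑ i, θ i ^ 2 - (∑ i, u i * θ i) ^ 2)) ^ 2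
          + ∑ r ∈ (univ.erase r₀).erase r₁, z r ^ 2 ∈ B} := by
  set uE : EuclideanSpace ℝ ι := toLp 2 u with huE
  set θE : EuclideanSpace ℝ ι := toLp 2 θ with hθE
  have hnu : ‖uE‖ = 1 := by
    have h2 : ‖uE‖ ^ 2 = 1 := by
      rw [EuclideanSpace.real_norm_sq_eq]
      simpa [huE] using hu
    have h0 : 0 ≤ ‖uE‖ := norm_nonneg _
    nlinarith [h2, h0]
  obtain ⟨b, hb0, hb1⟩ := exists_orthonormalBasis_unit_shift h01 hnu θE
  set κ := ‖θE - ⟪uE, θE⟫ • uE‖ with hκdef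
  have hκ : κ = Real.sqrt (∑ i, θ i ^ 2 - (∑ i, u i * θ i) ^ 2) := by
    have h2 : κ ^ 2 = ∑ i, θ i ^ 2 - (∑ i, u i * θ i) ^ 2 := by
      -- Pythagoras `‖θ − ⟨u,θ⟩u‖² = ‖θ‖² − ⟨u,θ⟩²` (folklore; in the tree for abstract spaces)
      have hpy : ‖θE - ⟪uE, θE⟫ • uE‖ ^ 2 = ‖θE‖ ^ 2 - ⟪uE, θE⟫ ^ 2 := by
        rw [norm_sub_sq_real, inner_smul_right, real_inner_comm uE θE, norm_smul, hnu, mul_one,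
          Real.norm_eq_abs, sq_abs]
        ring
      rw [hκdef, hpy, EuclideanSpace.real_norm_sq_eq, hθE, huE, real_inner_comm,
        inner_toLp_toLp_eq_sum]
    rw [← h2, Real.sqrt_sq (norm_nonneg _)]
  rw [← hκ]
  set O := b.repr with hO
  have hmp := measurePreserving_euclidean_isometry_pi (ι := ι) O
  have hBm : MeasurableSet {z : ι → ℝ | (z r₁ + κ) ^ 2 + ∑ r ∈ (univ.erase r₀).erase r₁, z r ^ 2 ∈ B} :=
    (by fun_prop : Measurable fun z : ι → ℝ =>
      (z r₁ + κ) ^ 2 + ∑ r ∈ (univ.erase r₀).erase r₁, z r ^ 2) hB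
  have hpre : {z : ι → ℝ | ∑ i, (z i + θ i) ^ 2 - (∑ i, u i * (z i + θ i)) ^ 2 ∈ B}
      = (fun z : ι → ℝ => ofLp (O (toLp 2 z))) ⁻¹'
          {z : ι → ℝ | (z r₁ + κ) ^ 2 + ∑ r ∈ (univ.erase r₀).erase r₁, z r ^ 2 ∈ B} := by
    ext z
    simp only [Set.mem_setOf_eq, Set.mem_preimage]
    have hco : ∀ r, (ofLp (O (toLp 2 z)) : ι → ℝ) r = ⟪b r, (toLp 2 z : EuclideanSpace ℝ ι)⟫ :=
      fun r => by rw [hO]; exact b.repr_apply_apply _ r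
    simp only [hco]
    rw [sum_sq_add_sub_sq_eq_norm, ← huE, ← hθE,
      norm_sq_sub_inner_sq_shift_eq h01 b hb0 hb1 (toLp 2 z)]
  rw [hpre, ← Measure.map_apply hmp.measurable hBm, hmp.map_eq]

/-- The central case `θ = 0` recovers `Scoring/GaussianCochranReduction`:
`N^{⊗ι}{(z_{r₁} + 0)² + Σ_{r ≠ r₀, r₁} z_r² ≤ c} = N^{⊗ι}{Σ_{r ≠ r₀} z_r² ≤ c}` (set equality). -/
theorem shiftedBall_zero_eq_erase {r₀ r₁ : ι} (h01 : r₀ ≠ r₁) (c : ℝ) :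
    {z : ι → ℝ | (z r₁ + 0) ^ 2 + ∑ r ∈ (univ.erase r₀).erase r₁, z r ^ 2 ≤ c}
      = {z : ι → ℝ | ∑ r ∈ univ.erase r₀, z r ^ 2 ≤ c} := by
  ext z
  simp only [Set.mem_setOf_eq, add_zero]
  rw [← Finset.add_sum_erase _ _ (Finset.mem_erase.2 ⟨h01.symm, Finset.mem_univ r₁⟩)]

end Cochran

/-! ## §3 The homogeneity statistic with DIFFERENT centres -/

section Homogeneity

variable {ι : Type*} [Fintype ι] [DecidableEq ι]

omit [DecidableEq ι] in
/-- **The homogeneity statistic with different centres, standardised**: with `x_i = μ_i + σ_i z_i`,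
`W = Σ_i σ_i⁻²`, `m̂ = (Σ_i x_i/σ_i²)/W`:
`Σ_i (x_i − m̂)²/σ_i² = Σ_i (z_i + μ_i/σ_i)² − (Σ_i (z_i + μ_i/σ_i)/σ_i)²/W` (`σ_i ≠ 0`, `W ≠ 0`). [ours] -/
theorem homogeneity_statistic_centres_eq (μ σ z : ι → ℝ) (hσ : ∀ i, σ i ≠ 0)
    (hW : ∑ i, (σ i ^ 2)⁻¹ ≠ 0) :
    ∑ i, ((μ i + σ i * z i) - (∑ j, (μ j + σ j * z j) / σ j ^ 2) / (∑ j, (σ j ^ 2)⁻¹)) ^ 2 / σ i ^ 2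
      = ∑ i, (z i + μ i / σ i) ^ 2 - (∑ i, (z i + μ i / σ i) / σ i) ^ 2 / ∑ i, (σ i ^ 2)⁻¹ := by
  have h := homogeneity_statistic_eq 0 σ (fun i => z i + μ i / σ i) hσ hW
  have e : ∀ i, (0 : ℝ) + σ i * (z i + μ i / σ i) = μ i + σ i * z i := fun i => by
    field_simp [hσ i]
    ring
  simp only [e] at h
  exact h

omit [DecidableEq ι] in
/-- **The non-centrality parameter is the homogeneity statistic of the TRUE centres**: with
`W = Σ_j σ_j⁻²`, `u_i = σ_i⁻¹/√W`, `μ̄_w = (Σ_j μ_j/σ_j²)/W`: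
`Σ_i (μ_i/σ_i)² − (Σ_i u_i μ_i/σ_i)² = Σ_i (μ_i − μ̄_w)²/σ_i²`. [ours] -/
theorem noncentrality_sq_eq [Nonempty ι] (μ σ : ι → ℝ) (hσ : ∀ i, 0 < σ i) :
    ∑ i, (μ i / σ i) ^ 2
        - (∑ i, ((σ i)⁻¹ / Real.sqrt (∑ j, (σ j ^ 2)⁻¹)) * (μ i / σ i)) ^ 2
      = ∑ i, (μ i - (∑ j, μ j / σ j ^ 2) / (∑ j, (σ j ^ 2)⁻¹)) ^ 2 / σ i ^ 2 := by
  have hW : 0 < ∑ j, (σ j ^ 2)⁻¹ :=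
    Finset.sum_pos (fun i _ => by have := hσ i; positivity) Finset.univ_nonempty
  have h := homogeneity_statistic_eq 0 σ (fun i => μ i / σ i) (fun i => (hσ i).ne') hW.ne'
  have e : ∀ i, (0 : ℝ) + σ i * (μ i / σ i) = μ i := fun i => by
    rw [zero_add, mul_div_cancel₀ _ (hσ i).ne']
  simp only [e] at h
  have hS : (∑ i, ((σ i)⁻¹ / Real.sqrt (∑ j, (σ j ^ 2)⁻¹)) * (μ i / σ i)) ^ 2
      = (∑ i, (μ i / σ i) / σ i) ^ 2 / ∑ j, (σ j ^ 2)⁻¹ := by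
    have : ∑ i, ((σ i)⁻¹ / Real.sqrt (∑ j, (σ j ^ 2)⁻¹)) * (μ i / σ i)
        = (∑ i, (μ i / σ i) / σ i) / Real.sqrt (∑ j, (σ j ^ 2)⁻¹) := by
      rw [Finset.sum_div]
      refine Finset.sum_congr rfl fun i _ => ?_
      field_simp
    rw [this, div_pow, Real.sq_sqrt hW.le]
  rw [hS]
  exact h.symm

/-- **THE `k`-ARM HOMOGENEITY FUNCTIONAL WITH DIFFERENT CENTRES IS A SHIFTED BALL.**  For `σ_i > 0`,
arbitrary centres `μ_i`, all `r₀ ≠ r₁` and every Borel `B`: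
`N(0,1)^{⊗ι}{z | Σ_i ((μ_i + σ_i z_i) − m̂(z))²/σ_i² ∈ B}
   = N(0,1)^{⊗ι}{z | (z_{r₁} + κ)² + Σ_{r ≠ r₀, r₁} z_r² ∈ B}`, `κ = √(Σ_i (μ_i − μ̄_w)²/σ_i²)`
— the law of the inverse-variance homogeneity statistic of independent `N(μ_i, σ_i²)` arm
estimates depends on `(μ, σ)` only through `κ`, the statistic of the true centres (textbook:
non-central `χ²_{k−1}(κ²)`; `κ = 0` iff all centres agree, then `Scoring/GaussianCochranReduction`). [ours] -/
theorem pi_gaussianReal_homogeneity_centres_eq_shiftedBall {r₀ r₁ : ι} (h01 : r₀ ≠ r₁)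
    (μ σ : ι → ℝ) (hσ : ∀ i, 0 < σ i) {B : Set ℝ} (hB : MeasurableSet B) :
    (Measure.pi fun _ : ι => gaussianReal 0 1)
        {z : ι → ℝ | ∑ i, ((μ i + σ i * z i) - (∑ j, (μ j + σ j * z j) / σ j ^ 2) / (∑ j, (σ j ^ 2)⁻¹)) ^ 2
          / σ i ^ 2 ∈ B}
      = (Measure.pi fun _ : ι => gaussianReal 0 1)
        {z : ι → ℝ | (z r₁ + Real.sqrt (∑ i, (μ i - (∑ j, μ j / σ j ^ 2) / (∑ j, (σ j ^ 2)⁻¹)) ^ 2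
            / σ i ^ 2)) ^ 2 + ∑ r ∈ (univ.erase r₀).erase r₁, z r ^ 2 ∈ B} := by
  have hne : Nonempty ι := ⟨r₀⟩
  set W := ∑ i, (σ i ^ 2)⁻¹ with hWdef
  have hW : 0 < W := Finset.sum_pos (fun i _ => by have := hσ i; positivity) Finset.univ_nonempty
  set u : ι → ℝ := fun i => (σ i)⁻¹ / Real.sqrt W with hu
  set θ : ι → ℝ := fun i => μ i / σ i with hθ
  have hu1 : ∑ i, u i ^ 2 = 1 := by
    simp only [hu, div_pow, inv_pow, Real.sq_sqrt hW.le]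
    rw [← Finset.sum_div, ← hWdef, div_self hW.ne']
  have hset : {z : ι → ℝ | ∑ i, ((μ i + σ i * z i) - (∑ j, (μ j + σ j * z j) / σ j ^ 2)
          / (∑ j, (σ j ^ 2)⁻¹)) ^ 2 / σ i ^ 2 ∈ B}
        = {z : ι → ℝ | ∑ i, (z i + θ i) ^ 2 - (∑ i, u i * (z i + θ i)) ^ 2 ∈ B} := by
    ext z
    simp only [Set.mem_setOf_eq]
    rw [homogeneity_statistic_centres_eq μ σ z (fun i => (hσ i).ne') hW.ne']
    have hS : (∑ i, u i * (z i + θ i)) ^ 2 = (∑ i, (z i + μ i / σ i) / σ i) ^ 2 / W := by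
      have : ∑ i, u i * (z i + θ i) = (∑ i, (z i + μ i / σ i) / σ i) / Real.sqrt W := by
        rw [Finset.sum_div]
        refine Finset.sum_congr rfl fun i _ => ?_
        simp only [hu, hθ]
        field_simp
      rw [this, div_pow, Real.sq_sqrt hW.le]
    rw [hS]
  have hκ : ∑ i, θ i ^ 2 - (∑ i, u i * θ i) ^ 2
      = ∑ i, (μ i - (∑ j, μ j / σ j ^ 2) / (∑ j, (σ j ^ 2)⁻¹)) ^ 2 / σ i ^ 2 := by
    simp only [hu, hθ, hWdef]
    exact noncentrality_sq_eq μ σ hσ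
  rw [hset, pi_gaussianReal_noncentral_cochran_eq h01 u θ hu1 hB, hκ]

end Homogeneity

end Summit.Ventures.LatticeQCDFlow.Scoring
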